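import Summits.AtomisticToContinuum.FouriersLaw.Theorems.ParityLiouvilleSeedWindowLimitLimitLaws
import Summits.AtomisticToContinuum.FouriersLaw.Theorems.ParityLiouvilleSeedWindowLimitMollify
import Summits.AtomisticToContinuum.FouriersLaw.Theorems.ParityLiouvilleSeedWindowLimitLiouvilleBounds

/-!
# Time invariance of a window limit (helper for `WindowLimit`)

Helper file for the route item `ParityLiouvilleSeed.WindowLimit` (`stmt-AtomisticToContinuum-13982`):
the **stationarity transfer**. For the pinned chain with ARBITRARY real parameters, a family of weak
steady states `μ_N` with site-uniform moments of all orders, lengths `Nk → ∞` and a weak limit `ν` of the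
centred window measures:

* `abs_embed_coord_le` — coordinates of an embedded configuration are bounded by `‖x‖`;
* `integral_liouvilleZ_window_limit_eq_zero_of_smooth` — for a SMOOTH profile `g` on the box `{-R, …, R}`
  with bounded values and gradient, `∫ 𝒜(g ∘ box_R) dν = 0`: the window averages of the continuous,
  cubically bounded observable `𝒜(g ∘ box_R)` converge to its `ν`-integral (`tendsto_integral_window`),
  and for `N` large each of them is `∫ L_N((g ∘ box_R) ∘ embed) dμ_N = 0` — the finite-chain generator on a
  bulk-window observable IS the Liouville operator (`generator_comp_embed_eq_liouvilleZ`, the bath terms do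
  not touch bulk coordinates) and weak stationarity extends to smooth polynomially bounded bulk observables
  (`integral_generator_eq_zero_of_polyGrowth`);
* `isTimeInvariant_window_limit` — `ν` is time invariant in Bernardin's sense (`IsTimeInvariant`): a `C₀¹`
  profile is approximated by smooth profiles with the same bounds and pointwise convergent gradients
  (`exists_smooth_approx_of_contDiff_one`), and dominated convergence (`|𝒜(g_j ∘ box_R)| ≤ A + B ∑ (|q|³+|p|³)`).

Nothing here closes an item.
-/

noncomputable section

namespace Summit.AtomisticToContinuum.FouriersLaw.Theorems.WindowLimit

open MeasureTheory Filter Topology Set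
open scoped ENNReal ContDiff
open Literature.MathematicalPhysics.KineticTheory
open Literature.MathematicalPhysics.KineticTheory.HeatConduction

/-- Coordinates of an embedded configuration are bounded by the norm of the phase-space point. [folklore] -/
theorem abs_embed_coord_le (N c : ℕ) (x : PhaseSpace N) (z : ℤ) :
    |(embed N c x z).1| ≤ ‖x‖ ∧ |(embed N c x z).2| ≤ ‖x‖ := by
  by_cases h : 0 ≤ z + c ∧ z + c < N
  · rw [embed_apply_of N c x h]
    exact abs_coord_le_norm x _
  · rw [embed_apply_of_not N c x h]
    simp

variable {ω₂ lam β γ T_L T_R : ℝ}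

/-- **`∫ 𝒜(g ∘ box_R) dν = 0` for smooth bounded profiles with bounded gradient** (window limit of weak
steady states of the pinned chain, any real parameters). [folklore] -/
theorem integral_liouvilleZ_window_limit_eq_zero_of_smooth (μ : (N : ℕ) → Measure (PhaseSpace N))
    (hss : ∀ N, (pinnedChain ω₂ lam β γ).IsSteadyState N T_L T_R (μ N))
    (hmom : ∀ m : ℕ, ∃ C : ℝ, ∀ (N : ℕ) (i : Fin N),
      Integrable (fun x : PhaseSpace N => |x.1 i| ^ m + |x.2 i| ^ m) (μ N) ∧
        ∫ x, (|x.1 i| ^ m + |x.2 i| ^ m) ∂(μ N) ≤ C)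
    {Nk : ℕ → ℕ} (hNk : Tendsto Nk atTop atTop) {ν : Measure ChainConfig} [IsProbabilityMeasure ν]
    (hlim : Tendsto (fun k => (haveI := (hss (Nk k)).1; windowPM (μ (Nk k)))) atTop (𝓝 (toPM ν)))
    (R : ℕ) {g : (Fin (2 * R + 1) → ℝ × ℝ) → ℝ} (hg : ContDiff ℝ ∞ g) {M M' : ℝ} (hM : ∀ y, |g y| ≤ M)
    (hM' : ∀ y, ‖fderiv ℝ g y‖ ≤ M') :
    Integrable (liouvilleZ (pinnedChain ω₂ lam β γ) (g ∘ boxRestrict R)) ν ∧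
      ∫ σ, liouvilleZ (pinnedChain ω₂ lam β γ) (g ∘ boxRestrict R) σ ∂ν = 0 := by
  set P := pinnedChain ω₂ lam β γ with hP
  have hprob : ∀ N, IsProbabilityMeasure (μ N) := fun N => (hss N).1
  have hg1 : ContDiff ℝ 1 g := hg.of_le (by norm_cast)
  have hgd : Differentiable ℝ g := hg1.differentiable one_ne_zero
  have hU : ContDiff ℝ ∞ P.U := pinnedChain_contDiff_U ω₂ lam β γ
  have hV : ContDiff ℝ ∞ P.V := pinnedChain_contDiff_V ω₂ lam β γ
  have hUd : Differentiable ℝ P.U := hU.differentiable (by simp)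
  have hVd : Differentiable ℝ P.V := hV.differentiable (by simp)
  set h : ChainConfig → ℝ := liouvilleZ P (g ∘ boxRestrict R) with hh
  have hcont : Continuous h := continuous_liouvilleZ_comp_boxRestrict ω₂ lam β γ R hg1
  -- the site-weight bound
  set C_F : ℝ := |ω₂| + |lam| + 4 + 8 * |β| with hCF
  set A : ℝ := M' * (2 * R + 1) * (1 + C_F) with hA
  set B : ℝ := M' * (2 * R + 1) * (1 + 3 * C_F) with hB
  set s : Finset ℤ := Finset.Icc (-(R : ℤ) - 1) (R + 1) with hs
  have hbd : ∀ σ, |h σ| ≤ A + B * ∑ z ∈ s, (|(σ z).1| ^ 3 + |(σ z).2| ^ 3) := fun σ =>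
    abs_liouvilleZ_comp_boxRestrict_le ω₂ lam β γ R hgd hM' σ
  obtain ⟨hint, hconv⟩ := tendsto_integral_window μ hprob hmom hlim hcont s 3 hbd
  refine ⟨hint, ?_⟩
  -- eventually every window average vanishes
  have hzero : ∀ᶠ k in atTop, ∫ x, h (embed (Nk k) (Nk k / 2) x) ∂(μ (Nk k)) = 0 := by
    filter_upwards [hNk.eventually_ge_atTop (2 * R + 6)] with k hk
    set N := Nk k with hN
    set c : ℕ := N / 2 with hc
    have hc1 : (1 : ℤ) ≤ -(R : ℤ) + (c : ℕ) := by omega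
    have hcN : -(R : ℤ) + (c : ℕ) + (2 * R : ℕ) + 2 ≤ N := by push_cast; omega
    have hc0 : (0 : ℤ) ≤ -(R : ℤ) + (c : ℕ) := by omega
    have hcN' : -(R : ℤ) + (c : ℕ) + (2 * R : ℕ) < N := by omega
    -- `h ∘ embed = L_N w` with `w = (g ∘ box) ∘ embed`
    set w : PhaseSpace N → ℝ := (g ∘ boxRestrictAt (-(R : ℤ)) (2 * R)) ∘ embed N c with hw
    have hfw : ∀ x, h (embed N c x) = P.generator N T_L T_R w x := by
      intro x
      rw [hh, boxRestrict_eq_boxRestrictAt, hw, generator_comp_embed_eq_liouvilleZ P hUd hVd T_L T_R hc1 hcN g x]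
    have hws : ContDiff ℝ ∞ w := contDiff_comp_embed hc0 hcN' hg
    have h0 : ∀ i : Fin N, i.val = 0 → ∀ x, partialP i w x = 0 := fun i hi x =>
      partialP_comp_embed_eq_zero_of_bath hc1 hcN g i (Or.inl hi) x
    have h1 : ∀ i : Fin N, i.val = N - 1 → ∀ x, partialP i w x = 0 := fun i hi x =>
      partialP_comp_embed_eq_zero_of_bath hc1 hcN g i (Or.inr hi) x
    -- growth bounds on `w` and `L w`
    have hA0 : 0 ≤ max A 0 := le_max_right _ _
    have hB0 : 0 ≤ max B 0 := le_max_right _ _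
    set C : ℝ := max (max M 0) (max A 0 + 2 * max B 0 * s.card) with hCdef
    have hone : ∀ x : PhaseSpace N, (1 : ℝ) ≤ (1 + ‖x‖) ^ 3 := fun x =>
      one_le_pow₀ (le_add_of_nonneg_right (norm_nonneg _))
    have hwb : ∀ x, |w x| ≤ C * (1 + ‖x‖) ^ 3 := by
      intro x
      have h1 : |w x| ≤ max M 0 := (hM _).trans (le_max_left _ _)
      calc |w x| ≤ max M 0 * 1 := by rw [mul_one]; exact h1
        _ ≤ C * (1 + ‖x‖) ^ 3 := mul_le_mul (le_max_left _ _) (hone x) zero_le_one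
            ((le_max_right _ _).trans (le_max_left _ _))
    have hLw : ∀ x, |P.generator N T_L T_R w x| ≤ C * (1 + ‖x‖) ^ 3 := by
      intro x
      rw [← hfw x]
      have hWx : ∑ z ∈ s, (|(embed N c x z).1| ^ 3 + |(embed N c x z).2| ^ 3) ≤ 2 * s.card * (1 + ‖x‖) ^ 3 := by
        have hle : ∀ z ∈ s, |(embed N c x z).1| ^ 3 + |(embed N c x z).2| ^ 3 ≤ 2 * (1 + ‖x‖) ^ 3 := by
          intro z _
          obtain ⟨a1, a2⟩ := abs_embed_coord_le N c x z
          have b1 : |(embed N c x z).1| ^ 3 ≤ (1 + ‖x‖) ^ 3 :=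
            pow_le_pow_left₀ (abs_nonneg _) (a1.trans (le_add_of_nonneg_left zero_le_one)) 3
          have b2 : |(embed N c x z).2| ^ 3 ≤ (1 + ‖x‖) ^ 3 :=
            pow_le_pow_left₀ (abs_nonneg _) (a2.trans (le_add_of_nonneg_left zero_le_one)) 3
          linarith
        calc _ ≤ ∑ _z ∈ s, 2 * (1 + ‖x‖) ^ 3 := Finset.sum_le_sum hle
          _ = 2 * s.card * (1 + ‖x‖) ^ 3 := by rw [Finset.sum_const, nsmul_eq_mul]; ring
      calc |h (embed N c x)| ≤ A + B * ∑ z ∈ s, (|(embed N c x z).1| ^ 3 + |(embed N c x z).2| ^ 3) := hbd _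
        _ ≤ max A 0 * (1 + ‖x‖) ^ 3 + max B 0 * (2 * s.card * (1 + ‖x‖) ^ 3) := by
            refine add_le_add ?_ ?_
            · calc A ≤ max A 0 * 1 := by rw [mul_one]; exact le_max_left _ _
                _ ≤ max A 0 * (1 + ‖x‖) ^ 3 := mul_le_mul_of_nonneg_left (hone x) hA0
            · calc B * ∑ z ∈ s, (|(embed N c x z).1| ^ 3 + |(embed N c x z).2| ^ 3)
                  ≤ max B 0 * ∑ z ∈ s, (|(embed N c x z).1| ^ 3 + |(embed N c x z).2| ^ 3) :=
                    mul_le_mul_of_nonneg_right (le_max_left _ _) (Finset.sum_nonneg fun z _ => by positivity)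
                _ ≤ max B 0 * (2 * s.card * (1 + ‖x‖) ^ 3) := mul_le_mul_of_nonneg_left hWx hB0
        _ = (max A 0 + 2 * max B 0 * s.card) * (1 + ‖x‖) ^ 3 := by ring
        _ ≤ C * (1 + ‖x‖) ^ 3 := mul_le_mul_of_nonneg_right (le_max_right _ _) (by positivity)
    -- weak stationarity on `w`
    have hmomN : ∀ K : ℕ, Integrable (fun x : PhaseSpace N => (1 + ‖x‖) ^ K) (μ N) := fun K => by
      obtain ⟨CK, hCK⟩ := hmom K
      exact integrable_one_add_norm_pow (μ N) K fun i => (hCK N i).1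
    have hz := integral_generator_eq_zero_of_polyGrowth P hU hV T_L T_R
      (fun i x => pinnedChain_abs_partialQ_hamiltonian_le ω₂ lam β γ x i) (μ N) (hss N).2.1 hmomN hws h0 h1
      hwb hLw
    simp only [hfw]
    exact hz
  have hconst : Tendsto (fun k => ∫ x, h (embed (Nk k) (Nk k / 2) x) ∂(μ (Nk k))) atTop (𝓝 0) :=
    tendsto_const_nhds.congr' (hzero.mono fun k hk => hk.symm)
  exact tendsto_nhds_unique hconv hconst

/-- **Time invariance of a window limit** (Bernardin's generator form, test class `C₀¹`): for the pinned
chain with ARBITRARY real parameters, a family of weak steady states with site-uniform moments of all orders,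
lengths `Nk → ∞` and a weak limit `ν` of the centred window measures, `ν` is time invariant for the
infinite dynamics: `𝒜f ∈ L¹(ν)` and `∫ 𝒜f dν = 0` for every local test function `f` (smooth approximation
of the `C¹` profile with pointwise convergent gradients, the smooth case, dominated convergence).
[Eyink–Lebowitz–Spohn 1991 architecture; Bernardin 2014 §1.1 Def. 1 footnote] [folklore] -/
theorem isTimeInvariant_window_limit (μ : (N : ℕ) → Measure (PhaseSpace N))
    (hss : ∀ N, (pinnedChain ω₂ lam β γ).IsSteadyState N T_L T_R (μ N))
    (hmom : ∀ m : ℕ, ∃ C : ℝ, ∀ (N : ℕ) (i : Fin N),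
      Integrable (fun x : PhaseSpace N => |x.1 i| ^ m + |x.2 i| ^ m) (μ N) ∧
        ∫ x, (|x.1 i| ^ m + |x.2 i| ^ m) ∂(μ N) ≤ C)
    {Nk : ℕ → ℕ} (hNk : Tendsto Nk atTop atTop) {ν : Measure ChainConfig} [IsProbabilityMeasure ν]
    (hlim : Tendsto (fun k => (haveI := (hss (Nk k)).1; windowPM (μ (Nk k)))) atTop (𝓝 (toPM ν))) :
    IsTimeInvariant (pinnedChain ω₂ lam β γ) ν := by
  have hprob : ∀ N, IsProbabilityMeasure (μ N) := fun N => (hss N).1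
  intro f hf
  obtain ⟨R, g, hg1, ⟨M, hM⟩, ⟨M', hM'⟩, rfl⟩ := hf
  have hgd : Differentiable ℝ g := hg1.differentiable one_ne_zero
  obtain ⟨gs, hgs, hgsM, hgsM', -, hgsD⟩ := exists_smooth_approx_of_contDiff_one hg1 hM hM'
  have hgsd : ∀ j, Differentiable ℝ (gs j) := fun j => (hgs j).differentiable (by simp)
  -- the smooth approximants
  have hj : ∀ j, Integrable (liouvilleZ (pinnedChain ω₂ lam β γ) (gs j ∘ boxRestrict R)) ν ∧
      ∫ σ, liouvilleZ (pinnedChain ω₂ lam β γ) (gs j ∘ boxRestrict R) σ ∂ν = 0 := fun j =>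
    integral_liouvilleZ_window_limit_eq_zero_of_smooth μ hss hmom hNk hlim R (hgs j) (hgsM j) (hgsM' j)
  -- the common dominating function
  set C_F : ℝ := |ω₂| + |lam| + 4 + 8 * |β| with hCF
  set A : ℝ := M' * (2 * R + 1) * (1 + C_F) with hA
  set B : ℝ := M' * (2 * R + 1) * (1 + 3 * C_F) with hB
  set s : Finset ℤ := Finset.Icc (-(R : ℤ) - 1) (R + 1) with hs
  set bound : ChainConfig → ℝ := fun σ => A + B * ∑ z ∈ s, (|(σ z).1| ^ 3 + |(σ z).2| ^ 3) with hbound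
  have hbd : ∀ j σ, |liouvilleZ (pinnedChain ω₂ lam β γ) (gs j ∘ boxRestrict R) σ| ≤ bound σ := fun j σ =>
    abs_liouvilleZ_comp_boxRestrict_le ω₂ lam β γ R (hgsd j) (hgsM' j) σ
  have hbdg : ∀ σ, |liouvilleZ (pinnedChain ω₂ lam β γ) (g ∘ boxRestrict R) σ| ≤ bound σ := fun σ =>
    abs_liouvilleZ_comp_boxRestrict_le ω₂ lam β γ R hgd hM' σ
  obtain ⟨C₃, hC₃⟩ := moments_of_window_limit μ hprob hmom hlim 3
  have hbound_int : Integrable bound ν :=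
    (integrable_const A).add ((integrable_finsetSum _ fun z _ => (hC₃ z).1).const_mul B)
  -- dominated convergence
  have hcont : Continuous (liouvilleZ (pinnedChain ω₂ lam β γ) (g ∘ boxRestrict R)) := continuous_liouvilleZ_comp_boxRestrict ω₂ lam β γ R hg1
  have hint : Integrable (liouvilleZ (pinnedChain ω₂ lam β γ) (g ∘ boxRestrict R)) ν :=
    hbound_int.mono' hcont.aestronglyMeasurable (Eventually.of_forall fun σ => by
      rw [Real.norm_eq_abs]; exact hbdg σ)
  refine ⟨hint, ?_⟩
  have hDCT := tendsto_integral_of_dominated_convergence bound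
    (fun j => (continuous_liouvilleZ_comp_boxRestrict ω₂ lam β γ R
      ((hgs j).of_le (by norm_cast))).aestronglyMeasurable)
    hbound_int (fun j => Eventually.of_forall fun σ => by rw [Real.norm_eq_abs]; exact hbd j σ)
    (Eventually.of_forall fun σ => tendsto_liouvilleZ_comp_boxRestrict (pinnedChain ω₂ lam β γ) R hgd hgsd hgsD σ)
  have h0 : ∀ j, ∫ σ, liouvilleZ (pinnedChain ω₂ lam β γ) (gs j ∘ boxRestrict R) σ ∂ν = 0 := fun j => (hj j).2
  simp only [h0] at hDCT
  exact tendsto_nhds_unique hDCT tendsto_const_nhds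

end Summit.AtomisticToContinuum.FouriersLaw.Theorems.WindowLimit

end
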